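import Literature.AnabelianGeometry.AbsoluteAnabelian.TPairs
import HarnessLib

/-!
# [AbsTopIII] Cor 5.2 (ii) / Rmk 5.2.3 (cyclotome isomorphism of a global `T`-pair) — CONDITIONAL
# INSTANCE FORMS with the FACT-LIST declarations as conclusion head (rows F-0186, F-0187)

S. Mochizuki, *Topics in absolute anabelian geometry III: global reconstruction algorithms*, J. Math. Sci.
Univ. Tokyo **22** (2015) [cite: MochizukiAbsTopIII2015], Cor 5.2 (ii) p. 119 ("there is a unique
isomorphism `μ_Ẑ(M⊚_TM) ≅ μ_Ẑ(Π)` that is compatible, relative to the `ρ_v`, with the isomorphisms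
`μ_Ẑ((M_v)_TM) ≅ μ_Ẑ(Π_v)` of Cor 1.10 (c), Rmk 3.2.1") and Rmk 5.2.3 pp. 121–122 (the `T = TLG` variant
via the archimedean primes).  PROOF-ONLY companion (theorems only; no `def`, no `instance`) of
`TPairs.lean` (abc-iut-L4-t3), where both are typed as PREDICATES on an abstract `TPairVocabulary R T`
whose cyclotomes `μ_Ẑ(−)` and compatibility predicates are UNINTERPRETED fields.

Bookkeeping context (abc-iut cell, block F, row INST59C of the LF kernel census): the universal closures
of F-0186 `CyclotomeIsoUnique` and F-0187 `CyclotomeIsoViaArchimedean` are REFUTED in tree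
(`TPairsCyclotomeSchemaWitnesses.lean`: compatibility `⊥` kills existence; an `𝔖₃`-cyclotome with
compatibility `⊤` kills uniqueness) and the rows are model-witnessed only inside the `∃`-statement
`exists_vocabulary_cyclotomeIso_facts` (degenerate vocabulary).  This file isolates the CLASS of
vocabularies the two closure refuters spare, as CONDITIONAL INSTANCE theorems whose conclusion head is
LITERALLY the FACT-LIST declaration:

* `cyclotomeIsoUnique_of_subsingleton` (F-0186): if the cyclotomes `μ_Ẑ(M)` and `μ_Ẑ(Π)` of the
  vocabulary are trivial (subsingleton) profinite groups and the compatibility predicate holds for every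
  candidate, then Cor 5.2 (ii) as typed holds — the unique isomorphism is `1 ≅ 1`;
* `cyclotomeIsoViaArchimedean_of_subsingleton` (F-0187): the same for the archimedean variant (`T = TLG`);
* `cyclotomeIsoViaArchimedean_of_forall_compatible` (F-0187, weaker hypotheses): existence alone needs
  only SOME bicontinuous isomorphism `μ_Ẑ(M⊚) ≅ μ_Ẑ(Π)` per pair and an always-true archimedean
  compatibility predicate.

Exactly the negations of the refuters' junk: `IsCyclotomeCompatible := ⊥` violates the compatibility
hypothesis, the `𝔖₃`-cyclotome violates the subsingleton hypothesis.  The INTENDED instance (`T ∈ {TF, TM,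
TLG}` of Def 3.1 (i) over the étale `π₁` of hyperbolic orbicurves, cyclotomic rigidity of Cor 1.10 (c)) is
not constructible in the tree; there Cor 5.2 (ii) is Mochizuki's corollary and stays a NAMED FACT.
HONEST FRAMING: statements about the cell's own interface typing; degenerate class; nothing of
[AbsTopIII] is asserted or denied; instantiated ≠ endorsed; nothing here bears on [IUTchIII] Cor 3.12.
-/

universe u

namespace Literature.AnabelianGeometry.AbsoluteAnabelian

open CategoryTheory Topology

variable {R : GlobalAnabelianContext.{u}} {T : TKind} (W : TPairVocabulary R T)

/-- Between profinite groups with one element each there is a (unique) bicontinuous isomorphism — the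
constant map `1 ↦ 1`. [folklore] -/
private theorem nonempty_continuousMulEquiv_of_subsingleton (A B : ProfiniteGrp.{u}) [Subsingleton A]
    [Subsingleton B] : Nonempty (A ≃ₜ* B) :=
  ⟨{ toFun := fun _ => 1
     invFun := fun _ => 1
     left_inv := fun _ => Subsingleton.elim _ _
     right_inv := fun _ => Subsingleton.elim _ _
     map_mul' := fun _ _ => Subsingleton.elim _ _
     continuous_toFun := continuous_const
     continuous_invFun := continuous_const }⟩

/-- **F-0186, CONDITIONAL INSTANCE (the class the closure refuters spare).**  For a `T`-pair vocabulary
whose cyclotomes `μ_Ẑ(M)` (`M ∈ Ob(T⊚)`) and `μ_Ẑ(Π)` are TRIVIAL profinite groups and whose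
compatibility predicate accepts every candidate isomorphism, [AbsTopIII] Cor 5.2 (ii) AS TYPED holds: for
every global `T`-pair there is exactly one compatible `μ_Ẑ(M⊚_TM) ≅ μ_Ẑ(Π)` (any two maps into a
one-element group agree).  DEGENERATE class (the genuine cyclotomes are `≅ Ẑ`); a statement about the
typing only. [cite: MochizukiAbsTopIII2015, Cor 5.2 (ii) p. 119] -/
theorem cyclotomeIsoUnique_of_subsingleton (hT : T ≠ TKind.TLG)
    (hM : ∀ M : W.GlobObj, Subsingleton (W.cyclotome M))
    (hGrp : ∀ E : FundamentalExtension.{u}, Subsingleton (W.cyclotomeGrp E))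
    (hc : ∀ (P : GlobalTPair W) (ι : W.cyclotome P.M ≃ₜ* W.cyclotomeGrp P.theater.ext),
      W.IsCyclotomeCompatible P.act ι) :
    Literature.AnabelianGeometry.AbsoluteAnabelian.CyclotomeIsoUnique W hT := by
  intro P
  haveI := hM P.M
  haveI := hGrp P.theater.ext
  obtain ⟨ι⟩ := nonempty_continuousMulEquiv_of_subsingleton (W.cyclotome P.M) (W.cyclotomeGrp P.theater.ext)
  exact ⟨ι, hc P ι, fun ι' _ => ContinuousMulEquiv.ext fun _ => Subsingleton.elim _ _⟩

/-- **F-0187, CONDITIONAL INSTANCE (the class the closure refuter spares).**  For a `TLG`-pair vocabulary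
with TRIVIAL cyclotomes and an archimedean compatibility predicate accepting every candidate, [AbsTopIII]
Rmk 5.2.3 AS TYPED holds: every global `TLG`-pair (with or without archimedean elements) carries a
compatible isomorphism `μ_Ẑ(M⊚) ≅ μ_Ẑ(Π)`.  DEGENERATE class; typing only.
[cite: MochizukiAbsTopIII2015, Rmk 5.2.3 pp. 121–122] -/
theorem cyclotomeIsoViaArchimedean_of_subsingleton (hT : T = TKind.TLG)
    (hM : ∀ M : W.GlobObj, Subsingleton (W.cyclotome M))
    (hGrp : ∀ E : FundamentalExtension.{u}, Subsingleton (W.cyclotomeGrp E))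
    (hc : ∀ (P : GlobalTPair W) (ι : W.cyclotome P.M ≃ₜ* W.cyclotomeGrp P.theater.ext),
      W.IsCyclotomeArchCompatible P.act ι) :
    Literature.AnabelianGeometry.AbsoluteAnabelian.CyclotomeIsoViaArchimedean W hT := by
  intro P _
  haveI := hM P.M
  haveI := hGrp P.theater.ext
  obtain ⟨ι⟩ := nonempty_continuousMulEquiv_of_subsingleton (W.cyclotome P.M) (W.cyclotomeGrp P.theater.ext)
  exact ⟨ι, hc P ι⟩

/-- **F-0187, CONDITIONAL INSTANCE with weaker hypotheses.**  Rmk 5.2.3 as typed is an EXISTENCE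
statement, so it already holds for every vocabulary in which each global pair admits SOME bicontinuous
isomorphism `μ_Ẑ(M⊚) ≅ μ_Ẑ(Π)` (e.g. both cyclotomes literally `Ẑ`) and the archimedean compatibility
predicate accepts every candidate; the cyclotomes need not be trivial.  Typing only.
[cite: MochizukiAbsTopIII2015, Rmk 5.2.3 pp. 121–122] -/
theorem cyclotomeIsoViaArchimedean_of_forall_compatible (hT : T = TKind.TLG)
    (hι : ∀ P : GlobalTPair W, Nonempty (W.cyclotome P.M ≃ₜ* W.cyclotomeGrp P.theater.ext))
    (hc : ∀ (P : GlobalTPair W) (ι : W.cyclotome P.M ≃ₜ* W.cyclotomeGrp P.theater.ext),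
      W.IsCyclotomeArchCompatible P.act ι) :
    Literature.AnabelianGeometry.AbsoluteAnabelian.CyclotomeIsoViaArchimedean W hT := by
  intro P _
  obtain ⟨ι⟩ := hι P
  exact ⟨ι, hc P ι⟩

/-- **F-0186, CONDITIONAL INSTANCE with weaker hypotheses.**  Cor 5.2 (ii) as typed holds for every
vocabulary in which each global pair admits some isomorphism `μ_Ẑ(M⊚_TM) ≅ μ_Ẑ(Π)`, the compatibility
predicate accepts every candidate, and `μ_Ẑ(Π)` is trivial (so that any two candidates agree); the
source cyclotome is then forced to be trivial too.  Typing only. [cite: MochizukiAbsTopIII2015, Cor 5.2 (ii) p. 119] -/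
theorem cyclotomeIsoUnique_of_forall_compatible (hT : T ≠ TKind.TLG)
    (hι : ∀ P : GlobalTPair W, Nonempty (W.cyclotome P.M ≃ₜ* W.cyclotomeGrp P.theater.ext))
    (hGrp : ∀ E : FundamentalExtension.{u}, Subsingleton (W.cyclotomeGrp E))
    (hc : ∀ (P : GlobalTPair W) (ι : W.cyclotome P.M ≃ₜ* W.cyclotomeGrp P.theater.ext),
      W.IsCyclotomeCompatible P.act ι) :
    Literature.AnabelianGeometry.AbsoluteAnabelian.CyclotomeIsoUnique W hT := by
  intro P
  haveI := hGrp P.theater.ext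
  obtain ⟨ι⟩ := hι P
  exact ⟨ι, hc P ι, fun ι' _ => ContinuousMulEquiv.ext fun _ => Subsingleton.elim _ _⟩

end Literature.AnabelianGeometry.AbsoluteAnabelian
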